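import Summits.AtomisticToContinuum.HydrodynamicLimit.Theorems.StiffCollisionalRelaxationAprioriBoundsMesoOnePtShift
import HarnessLib

/-!
# Level-Lipschitz bound for the insertion ratios of the canonical hard-sphere gas

Helper file (`--supports stmt-AtomisticToContinuum-14827`, crux `AprioriBounds` of the stiff collisional
relaxation route, line `meso-chebyshev-window`): piece (a) of the `s = 0` inhomogeneous rung of the
registered stub `stub_mesoVariance` (Poisson-order variance of the kernel-smoothed density under the
local Gibbs law), which reduces to a quantitative canonical cluster-expansion estimate for `N + 1`
hard spheres of diameter `ε_N = σ (N+1)^{-1/3}` (`hsDiameter`) on `𝕋³` with one-particle law `β dy`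
(`DensityProfile`). In the notation of `Literature/MathematicalPhysics/KineticTheory/HardSphereEulerRatio`
(`Ξ_N(m) = XiN`, `q_N(m) = Ξ_N(m)/Ξ_N(m+1) = qN`, `r_N(m, j) = Ξ_N(m-j)/Ξ_N(m) = rN`,
`C(m, j) W^g_N(j+1) = coefN`, `p_{ε_N} = pOv`, `λ = ovDensity P σ = (N+1) p_{ε_N}`,
`θ = 2eλ = geomRatio P σ`, `κ = eθ/(1-θ)² = contractionC P σ`), the one new input is that the
insertion ratios are **Lipschitz in the level** with constant `O(λ/(N+1))` (one exclusion volume):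

  `|q_N(k+1) - q_N(k)| ≤ (32 e²/(1-θ)²) · λ/(N+1)` for `k + 1 ≤ N` (`ratioLip_qN_succ_sub_le`),

under the smallness conditions `SmallDensity P σ` of that file.

## Proof

Strong induction on the level `m`. Subtracting the ratio identities
`1/q_N(m) = ∑_{j ≤ m} C(m,j) W¹(j+1) r_N(m,j)` (`inv_qN_eq_sum`) at the levels `m + 1` and `m`
(`ratioLip_inv_qN_succ_sub_eq`) leaves three kinds of terms, all `O(p_{ε_N})`:
* (2a) the binomial differences `[C(m+1,j) - C(m,j)] W¹(j+1) = C(m,j-1) W¹(j+1)` (Pascal), one order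
  smaller than the coefficients themselves: `≤ p_{ε_N} e² j (eλ)^{j-1}` by the tree bound `abs_Wd_le`
  and `t(k+2) yᵏ/k! ≤ e² (k+1) (ey)ᵏ` (`tpt_coefN_succ_sub`, `tpt_abs_choose_mul_Wd_le` of the landed
  `…MesoOnePtShift`); against `r_N ≤ 2ʲ` and summed with `∑ (j+1) θʲ = (1-θ)⁻²`:
  `≤ 2e² p_{ε_N}/(1-θ)²` (`ratioLip_sum_abs_coefN_sub_mul_rN_le`);
* (2b) the level differences of the products `r_N(m+1,j) - r_N(m,j)`, controlled through the recursion
  `r_N(m,j+1) = r_N(m,j) q_N(m-1-j)` by the induction hypothesis at the lower levels `m-1-j < m`: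
  `≤ j 2ʲ η/2` (`ratioLip_abs_rN_succ_sub_le`); against `|C(m,j) W¹(j+1)| ≤ e(eλ)ʲ` and summed with
  `e ∑ j θʲ ≤ κ`: `≤ κη/2` (`ratioLip_sum_abs_coefN_mul_rN_sub_le`);
* (3) the boundary term `C(m+1,m+1) W¹(m+2) r_N(m+1,m+1) ≤ e (θ (m+1)/(N+1))^{m+1} ≤ κ/(N+1)` by the
  level-dependent coefficient bound `|C(m,j) W¹(j+1)| ≤ e (e m p_{ε_N})ʲ`
  (`tpt_abs_coefN_le_level` of `…MesoOnePtShift`, `ratioLip_abs_coefN_mul_rN_boundary_le`).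
Since `1 ≤ q_N ≤ 2`, `|q_N(m+1) - q_N(m)| ≤ 4 |1/q_N(m+1) - 1/q_N(m)| ≤ 16 e² p_{ε_N}/(1-θ)² + 2κη`, and
`4κ < 1` (`SmallDensity.four_contractionC_lt_one`) closes the induction with `η = 32 e² p_{ε_N}/(1-θ)²`
(`ratioLip_abs_qN_succ_sub_le_step`, `ratioLip_qN_succ_sub_le_pOv`).

No definitions, no named facts; axioms `propext`, `Classical.choice`, `Quot.sound`. The elementary
positivity/contraction route of `HardSphereEulerRatio` made quantitative in the level (cf. the finite-volume
corrections of E. Pulvirenti, D. Tsagkarogiannis, Comm. Math. Phys. 316 (2012) 289–306, §3–5).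
-/

namespace Summit.AtomisticToContinuum.HydrodynamicLimit.Theorems.MesoChebyshevWindow

open Literature.MathematicalPhysics.KineticTheory Literature.Probability.LatticeModels Finset

section

variable {P : DensityProfile} {σ : ℝ}

/-! ### Level differences of the products of ratios, and the level-difference identity -/

/-- **Level differences of the products of ratios.** If `|q_N(k+1) - q_N(k)| ≤ η` for all
`k + 1 ≤ m` (`m ≤ N`), then `|r_N(m+1, j) - r_N(m, j)| ≤ j 2ʲ η / 2` for `j ≤ m` (from the recursion
`r_N(m, j+1) = r_N(m, j) q_N(m-1-j)` and `0 ≤ q_N ≤ 2`, `0 ≤ r_N(m, j) ≤ 2ʲ`; the factor `1/2` sharper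
than `tpt_abs_rN_succ_sub_le` is what makes the induction close with the constant `32 e²/(1-θ)²`). -/
theorem ratioLip_abs_rN_succ_sub_le (hs : SmallDensity P σ) {N m : ℕ} (hm : m ≤ N) {η : ℝ} (hη : 0 ≤ η)
    (hIH : ∀ k, k + 1 ≤ m → |qN P σ N (k + 1) - qN P σ N k| ≤ η) :
    ∀ {j : ℕ}, j ≤ m → |rN P σ N (m + 1) j - rN P σ N m j| ≤ j * 2 ^ j * η / 2 := by
  obtain ⟨hσ, hσ2, hlam⟩ := And.intro hs.σ_pos.le (And.intro hs.σ_lt_half hs.ovDensity_lt_one)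
  intro j
  induction j with
  | zero =>
      intro _
      rw [rN_zero hσ hσ2 hlam (by omega : m + 1 ≤ N + 1), rN_zero hσ hσ2 hlam (by omega : m ≤ N + 1),
        sub_self, abs_zero]
      simp
  | succ j ih =>
      intro hj
      have ih' := ih (by omega)
      have hk : m + 1 - 1 - j = (m - 1 - j) + 1 := by omega
      rw [rN_succ hσ hσ2 hlam (by omega : m + 1 ≤ N + 1) (by omega : j + 1 ≤ m + 1),
        rN_succ hσ hσ2 hlam (by omega : m ≤ N + 1) hj, hk]
      have hq := hIH (m - 1 - j) (by omega)
      have hq0 : 0 ≤ qN P σ N (m - 1 - j + 1) := (qN_pos hσ hσ2 hlam (by omega)).le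
      have hq2 : qN P σ N (m - 1 - j + 1) ≤ 2 := hs.qN_le_two (by omega)
      have hr0 : 0 ≤ rN P σ N m j := zero_le_one.trans (one_le_rN hσ hσ2 hlam (by omega) (by omega))
      have hr2 : rN P σ N m j ≤ 2 ^ j := hs.rN_le_two_pow (by omega) (by omega)
      have hsplit : rN P σ N (m + 1) j * qN P σ N (m - 1 - j + 1) - rN P σ N m j * qN P σ N (m - 1 - j) =
          (rN P σ N (m + 1) j - rN P σ N m j) * qN P σ N (m - 1 - j + 1) +
            rN P σ N m j * (qN P σ N (m - 1 - j + 1) - qN P σ N (m - 1 - j)) := by ring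
      rw [hsplit]
      calc |(rN P σ N (m + 1) j - rN P σ N m j) * qN P σ N (m - 1 - j + 1) +
            rN P σ N m j * (qN P σ N (m - 1 - j + 1) - qN P σ N (m - 1 - j))|
          ≤ |(rN P σ N (m + 1) j - rN P σ N m j) * qN P σ N (m - 1 - j + 1)| +
            |rN P σ N m j * (qN P σ N (m - 1 - j + 1) - qN P σ N (m - 1 - j))| := abs_add_le _ _
        _ = |rN P σ N (m + 1) j - rN P σ N m j| * qN P σ N (m - 1 - j + 1) +
            rN P σ N m j * |qN P σ N (m - 1 - j + 1) - qN P σ N (m - 1 - j)| := by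
            rw [abs_mul, abs_mul, abs_of_nonneg hq0, abs_of_nonneg hr0]
        _ ≤ (j * 2 ^ j * η / 2) * 2 + 2 ^ j * η := by gcongr
        _ = (j + 1 : ℕ) * 2 ^ (j + 1) * η / 2 := by push_cast; ring

/-- **The level-difference identity** (the ratio identity `1/q_N(m) = ∑_{j ≤ m} C(m,j) W¹(j+1) r_N(m,j)`
at the levels `m + 1` and `m`, subtracted term by term):
`1/q_N(m+1) - 1/q_N(m) = ∑_{j ≤ m} ([C(m+1,j) - C(m,j)] W¹(j+1) r_N(m+1,j)
  + C(m,j) W¹(j+1) [r_N(m+1,j) - r_N(m,j)]) + C(m+1,m+1) W¹(m+2) r_N(m+1,m+1)`. -/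
theorem ratioLip_inv_qN_succ_sub_eq (hs : SmallDensity P σ) {N m : ℕ} (hm : m + 1 ≤ N) :
    (qN P σ N (m + 1))⁻¹ - (qN P σ N m)⁻¹ =
      ∑ j ∈ range (m + 1),
        ((coefN P σ N (fun _ => 1) (m + 1) j - coefN P σ N (fun _ => 1) m j) * rN P σ N (m + 1) j +
          coefN P σ N (fun _ => 1) m j * (rN P σ N (m + 1) j - rN P σ N m j)) +
      coefN P σ N (fun _ => 1) (m + 1) (m + 1) * rN P σ N (m + 1) (m + 1) := by
  rw [inv_qN_eq_sum hs.σ_pos.le hs.σ_lt_half hs.ovDensity_lt_one hm,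
    inv_qN_eq_sum hs.σ_pos.le hs.σ_lt_half hs.ovDensity_lt_one (by omega : m ≤ N), sum_range_succ]
  have h : ∀ j, (coefN P σ N (fun _ => 1) (m + 1) j - coefN P σ N (fun _ => 1) m j) * rN P σ N (m + 1) j +
      coefN P σ N (fun _ => 1) m j * (rN P σ N (m + 1) j - rN P σ N m j) =
      coefN P σ N (fun _ => 1) (m + 1) j * rN P σ N (m + 1) j - coefN P σ N (fun _ => 1) m j * rN P σ N m j := by
    intro j; ring
  simp_rw [h, sum_sub_distrib]
  ring

/-! ### The three bounds -/

/-- **Term (2a)**: `∑_{j ≤ m} |C(m+1,j) - C(m,j)| |W¹(j+1)| r_N(m+1,j) ≤ 2 e² p_{ε_N} / (1-θ)²`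
(`m + 1 ≤ N`; the `j = 0` term vanishes, and `∑_j (j+1) θʲ ≤ (1-θ)⁻²`). -/
theorem ratioLip_sum_abs_coefN_sub_mul_rN_le (hs : SmallDensity P σ) {N m : ℕ} (hm : m + 1 ≤ N) :
    ∑ j ∈ range (m + 1), |coefN P σ N (fun _ => 1) (m + 1) j - coefN P σ N (fun _ => 1) m j| *
        rN P σ N (m + 1) j ≤
      2 * Real.exp 1 ^ 2 * pOv P (hsDiameter σ N) / (1 - geomRatio P σ) ^ 2 := by
  obtain ⟨hσ, hσ2, hlam⟩ := And.intro hs.σ_pos.le (And.intro hs.σ_lt_half hs.ovDensity_lt_one)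
  have hθ0 := hs.geomRatio_nonneg
  have hp : 0 ≤ pOv P (hsDiameter σ N) := pOv_nonneg P (hsDiameter_nonneg' hσ N)
  rw [sum_range_succ', coefN_one_zero, coefN_one_zero, sub_self, abs_zero, zero_mul, add_zero]
  have hterm : ∀ j ∈ range m,
      |coefN P σ N (fun _ => 1) (m + 1) (j + 1) - coefN P σ N (fun _ => 1) m (j + 1)| * rN P σ N (m + 1) (j + 1) ≤
        2 * Real.exp 1 ^ 2 * pOv P (hsDiameter σ N) * (((j : ℝ) + 1) * geomRatio P σ ^ j) := by
    intro j hj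
    have hjm : j < m := mem_range.mp hj
    have hc := tpt_abs_choose_mul_Wd_le hs (g := fun _ => (1 : ℝ)) measurable_const (C := 1)
      (fun _ => by simp) (N := N) (m := m) (k := j) (by omega) (by omega)
    rw [one_mul] at hc
    have hr0 : 0 ≤ rN P σ N (m + 1) (j + 1) := zero_le_one.trans (one_le_rN hσ hσ2 hlam (by omega) (by omega))
    have hr2 : rN P σ N (m + 1) (j + 1) ≤ 2 ^ (j + 1) := hs.rN_le_two_pow (by omega) (by omega)
    rw [tpt_coefN_succ_sub]
    calc |(m.choose j : ℝ) * Wd P (hsDiameter σ N) (N + 1) (fun _ => 1) (j + 2)| * rN P σ N (m + 1) (j + 1)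
        ≤ pOv P (hsDiameter σ N) * (Real.exp 1 ^ 2 * ((j : ℝ) + 1) * (Real.exp 1 * ovDensity P σ) ^ j) *
          2 ^ (j + 1) := mul_le_mul hc hr2 hr0 (by have := hs.ovDensity_nonneg; positivity)
      _ = 2 * Real.exp 1 ^ 2 * pOv P (hsDiameter σ N) * (((j : ℝ) + 1) * geomRatio P σ ^ j) := by
          rw [geomRatio, pow_succ, show (2 * Real.exp 1 * ovDensity P σ) ^ j =
            2 ^ j * (Real.exp 1 * ovDensity P σ) ^ j by rw [← mul_pow]; ring_nf]
          ring
  refine (sum_le_sum hterm).trans ?_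
  rw [← mul_sum]
  -- `∑_{j<m} (j+1) θʲ ≤ θ/(1-θ)² + (1-θ)⁻¹ = (1-θ)⁻²`
  have hS : ∑ j ∈ range m, ((j : ℝ) + 1) * geomRatio P σ ^ j ≤ 1 / (1 - geomRatio P σ) ^ 2 := by
    refine (tpt_sum_succ_mul_pow_le hs m).trans (le_of_eq ?_)
    have h1 : (1 - geomRatio P σ) ≠ 0 := by linarith [hs.geomRatio_lt_one]
    field_simp
    ring
  calc 2 * Real.exp 1 ^ 2 * pOv P (hsDiameter σ N) * ∑ j ∈ range m, ((j : ℝ) + 1) * geomRatio P σ ^ j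
      ≤ 2 * Real.exp 1 ^ 2 * pOv P (hsDiameter σ N) * (1 / (1 - geomRatio P σ) ^ 2) :=
        mul_le_mul_of_nonneg_left hS (by positivity)
    _ = 2 * Real.exp 1 ^ 2 * pOv P (hsDiameter σ N) / (1 - geomRatio P σ) ^ 2 := by ring

/-- **Term (2b)**: if `|q_N(k+1) - q_N(k)| ≤ η` for `k + 1 ≤ m` then
`∑_{j ≤ m} |C(m,j) W¹(j+1)| |r_N(m+1,j) - r_N(m,j)| ≤ κ η / 2`, `κ = eθ/(1-θ)²` (`m + 1 ≤ N`). -/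
theorem ratioLip_sum_abs_coefN_mul_rN_sub_le (hs : SmallDensity P σ) {N m : ℕ} (hm : m + 1 ≤ N) {η : ℝ}
    (hη : 0 ≤ η) (hIH : ∀ k, k + 1 ≤ m → |qN P σ N (k + 1) - qN P σ N k| ≤ η) :
    ∑ j ∈ range (m + 1), |coefN P σ N (fun _ => 1) m j| * |rN P σ N (m + 1) j - rN P σ N m j| ≤
      contractionC P σ * η / 2 := by
  have hθ0 := hs.geomRatio_nonneg
  have hterm : ∀ j ∈ range (m + 1), |coefN P σ N (fun _ => 1) m j| * |rN P σ N (m + 1) j - rN P σ N m j| ≤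
      Real.exp 1 * ((j : ℝ) * geomRatio P σ ^ j) * (η / 2) := by
    intro j hj
    have hjm : j ≤ m := Nat.lt_succ_iff.mp (mem_range.mp hj)
    have hc := abs_coefN_le (P := P) hs.σ_pos.le hs.σ_lt_half (g := fun _ => (1 : ℝ)) measurable_const
      (C := 1) (fun _ => by simp) (N := N) (m := m) (j := j) (by omega) (by omega)
    rw [one_mul] at hc
    have hr := ratioLip_abs_rN_succ_sub_le hs (by omega : m ≤ N) hη hIH hjm
    calc |coefN P σ N (fun _ => 1) m j| * |rN P σ N (m + 1) j - rN P σ N m j|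
        ≤ (Real.exp 1 * (Real.exp 1 * ovDensity P σ) ^ j) * (j * 2 ^ j * η / 2) :=
          mul_le_mul hc hr (abs_nonneg _) (by have := hs.ovDensity_nonneg; positivity)
      _ = Real.exp 1 * ((j : ℝ) * geomRatio P σ ^ j) * (η / 2) := by
          rw [geomRatio, show (2 * Real.exp 1 * ovDensity P σ) ^ j = 2 ^ j * (Real.exp 1 * ovDensity P σ) ^ j by
            rw [← mul_pow]; ring_nf]
          ring
  refine (sum_le_sum hterm).trans ?_
  rw [← sum_mul, ← mul_sum]
  calc Real.exp 1 * (∑ j ∈ range (m + 1), (j : ℝ) * geomRatio P σ ^ j) * (η / 2)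
      ≤ contractionC P σ * (η / 2) := mul_le_mul_of_nonneg_right (hs.sum_mul_geomRatio_pow_le m) (by positivity)
    _ = contractionC P σ * η / 2 := by ring

/-- **Term (3)**, the boundary `j = m + 1`: `|C(m+1,m+1) W¹(m+2)| r_N(m+1,m+1) ≤ κ/(N+1)` for
`m + 1 ≤ N`, `κ = eθ/(1-θ)²` (level-dependent coefficient bound `tpt_abs_coefN_le_level`: the term is
`≤ e (θ (m+1)/(N+1))^{m+1} ≤ e θ^{m+1} (m+1)/(N+1)`, and `(m+1) θ^{m+1} ≤ θ/(1-θ)²`). -/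
theorem ratioLip_abs_coefN_mul_rN_boundary_le (hs : SmallDensity P σ) {N m : ℕ} (hm : m + 1 ≤ N) :
    |coefN P σ N (fun _ => 1) (m + 1) (m + 1)| * rN P σ N (m + 1) (m + 1) ≤
      contractionC P σ / ((N : ℝ) + 1) := by
  obtain ⟨hσ, hσ2, hlam⟩ := And.intro hs.σ_pos.le (And.intro hs.σ_lt_half hs.ovDensity_lt_one)
  have hθ0 := hs.geomRatio_nonneg
  have hp0 : 0 ≤ pOv P (hsDiameter σ N) := pOv_nonneg P (hsDiameter_nonneg' hσ N)
  have hc := tpt_abs_coefN_le_level hs (g := fun _ => (1 : ℝ)) measurable_const (C := 1)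
    (fun _ => by simp) (N := N) (m := m + 1) (j := m + 1) (by omega)
  rw [one_mul] at hc
  have hr0 : 0 ≤ rN P σ N (m + 1) (m + 1) := zero_le_one.trans (one_le_rN hσ hσ2 hlam (by omega) le_rfl)
  have hr2 : rN P σ N (m + 1) (m + 1) ≤ 2 ^ (m + 1) := hs.rN_le_two_pow (by omega) le_rfl
  have hMθ := tpt_nat_mul_pow_le hs (m + 1)
  have hN : (0 : ℝ) < (N : ℝ) + 1 := by positivity
  -- `t = (m+1)/(N+1) ∈ [0, 1]`
  obtain ⟨t, ht⟩ : ∃ t : ℝ, t = ((m + 1 : ℕ) : ℝ) / ((N : ℝ) + 1) := ⟨_, rfl⟩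
  have ht0 : 0 ≤ t := by rw [ht]; positivity
  have ht1 : t ≤ 1 := by
    rw [ht, div_le_one hN]
    exact_mod_cast hm.trans (Nat.le_succ N)
  have hmp : ((m + 1 : ℕ) : ℝ) * pOv P (hsDiameter σ N) = ovDensity P σ * t := by
    rw [pOv_hsDiameter, ht]; push_cast; ring
  calc |coefN P σ N (fun _ => 1) (m + 1) (m + 1)| * rN P σ N (m + 1) (m + 1)
      ≤ (Real.exp 1 * (Real.exp 1 * (((m + 1 : ℕ) : ℝ) * pOv P (hsDiameter σ N))) ^ (m + 1)) *
          2 ^ (m + 1) := mul_le_mul hc hr2 hr0 (by positivity)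
    _ = Real.exp 1 * (geomRatio P σ ^ (m + 1) * t ^ (m + 1)) := by rw [hmp, geomRatio]; ring
    _ ≤ Real.exp 1 * (geomRatio P σ ^ (m + 1) * t) := by
        gcongr
        exact pow_le_of_le_one ht0 ht1 (by omega)
    _ = Real.exp 1 * (((m + 1 : ℕ) : ℝ) * geomRatio P σ ^ (m + 1)) / ((N : ℝ) + 1) := by rw [ht]; ring
    _ ≤ Real.exp 1 * (geomRatio P σ / (1 - geomRatio P σ) ^ 2) / ((N : ℝ) + 1) := by gcongr
    _ = contractionC P σ / ((N : ℝ) + 1) := by rw [contractionC]; ring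

/-! ### The induction -/

/-- From inverses to ratios: `|q_N(m+1) - q_N(m)| ≤ 4 |1/q_N(m+1) - 1/q_N(m)|` (`0 < q_N ≤ 2`). -/
theorem ratioLip_abs_qN_succ_sub_le_inv (hs : SmallDensity P σ) {N m : ℕ} (hm : m + 1 ≤ N) :
    |qN P σ N (m + 1) - qN P σ N m| ≤ 4 * |(qN P σ N (m + 1))⁻¹ - (qN P σ N m)⁻¹| := by
  have hq0 := qN_pos hs.σ_pos.le hs.σ_lt_half hs.ovDensity_lt_one hm
  have hq2 := hs.qN_le_two hm
  have hq0' := qN_pos hs.σ_pos.le hs.σ_lt_half hs.ovDensity_lt_one (by omega : m ≤ N)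
  have hq2' := hs.qN_le_two (by omega : m ≤ N)
  have key : qN P σ N (m + 1) - qN P σ N m =
      qN P σ N (m + 1) * qN P σ N m * ((qN P σ N m)⁻¹ - (qN P σ N (m + 1))⁻¹) := by
    rw [mul_sub, mul_assoc, mul_inv_cancel₀ hq0'.ne', mul_one, mul_comm (qN P σ N (m + 1)) (qN P σ N m),
      mul_assoc, mul_inv_cancel₀ hq0.ne', mul_one]
  rw [key, abs_mul, abs_mul, abs_of_pos hq0, abs_of_pos hq0', abs_sub_comm]
  have h4 : qN P σ N (m + 1) * qN P σ N m ≤ 4 := by nlinarith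
  exact mul_le_mul_of_nonneg_right h4 (abs_nonneg _)

/-- **The induction step.** If `|q_N(k+1) - q_N(k)| ≤ η` for all `k + 1 ≤ m` (`m + 1 ≤ N`), then
`|q_N(m+1) - q_N(m)| ≤ 16 e² p_{ε_N}/(1-θ)² + η/2`: by the identity and the bounds (2a), (2b), (3),
`|1/q_N(m+1) - 1/q_N(m)| ≤ 4 e² p_{ε_N}/(1-θ)² + κη/2` (`κ/(N+1) = 2e² p_{ε_N}/(1-θ)²`), and
`2κ < 1/2` (`SmallDensity.four_contractionC_lt_one`). -/
theorem ratioLip_abs_qN_succ_sub_le_step (hs : SmallDensity P σ) {N m : ℕ} (hm : m + 1 ≤ N) {η : ℝ}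
    (hη : 0 ≤ η) (hIH : ∀ k, k + 1 ≤ m → |qN P σ N (k + 1) - qN P σ N k| ≤ η) :
    |qN P σ N (m + 1) - qN P σ N m| ≤
      16 * Real.exp 1 ^ 2 * pOv P (hsDiameter σ N) / (1 - geomRatio P σ) ^ 2 + η / 2 := by
  have hA := ratioLip_sum_abs_coefN_sub_mul_rN_le hs hm
  have hB := ratioLip_sum_abs_coefN_mul_rN_sub_le hs hm hη hIH
  have hBd := ratioLip_abs_coefN_mul_rN_boundary_le hs hm
  have hκ4 := hs.four_contractionC_lt_one
  have hκ0 := hs.contractionC_nonneg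
  have hr0 : ∀ {j : ℕ}, j ≤ m + 1 → 0 ≤ rN P σ N (m + 1) j := fun hj =>
    zero_le_one.trans (one_le_rN hs.σ_pos.le hs.σ_lt_half hs.ovDensity_lt_one (by omega) hj)
  -- the inverse difference
  have hinv : |(qN P σ N (m + 1))⁻¹ - (qN P σ N m)⁻¹| ≤
      2 * Real.exp 1 ^ 2 * pOv P (hsDiameter σ N) / (1 - geomRatio P σ) ^ 2 + contractionC P σ * η / 2 +
        contractionC P σ / ((N : ℝ) + 1) := by
    rw [ratioLip_inv_qN_succ_sub_eq hs hm]
    refine (abs_add_le _ _).trans (add_le_add ?_ ?_)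
    · refine (abs_sum_le_sum_abs _ _).trans ?_
      have hterm : ∀ j ∈ range (m + 1),
          |(coefN P σ N (fun _ => 1) (m + 1) j - coefN P σ N (fun _ => 1) m j) * rN P σ N (m + 1) j +
              coefN P σ N (fun _ => 1) m j * (rN P σ N (m + 1) j - rN P σ N m j)| ≤
            |coefN P σ N (fun _ => 1) (m + 1) j - coefN P σ N (fun _ => 1) m j| * rN P σ N (m + 1) j +
              |coefN P σ N (fun _ => 1) m j| * |rN P σ N (m + 1) j - rN P σ N m j| := by
        intro j hj
        have hjm : j ≤ m := Nat.lt_succ_iff.mp (mem_range.mp hj)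
        refine (abs_add_le _ _).trans (le_of_eq ?_)
        rw [abs_mul, abs_mul, abs_of_nonneg (hr0 (by omega))]
      refine (sum_le_sum hterm).trans ?_
      rw [sum_add_distrib]
      exact add_le_add hA hB
    · rw [abs_mul, abs_of_nonneg (hr0 le_rfl)]
      exact hBd
  -- `κ/(N+1) = 2 e² p_{ε_N}/(1-θ)²`
  have hκN : contractionC P σ / ((N : ℝ) + 1) =
      2 * Real.exp 1 ^ 2 * pOv P (hsDiameter σ N) / (1 - geomRatio P σ) ^ 2 := by
    rw [contractionC, geomRatio, pOv_hsDiameter]; push_cast; ring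
  rw [hκN] at hinv
  refine (ratioLip_abs_qN_succ_sub_le_inv hs hm).trans ?_
  have h2κ : 2 * contractionC P σ * η ≤ η / 2 := by nlinarith
  have hX : 16 * Real.exp 1 ^ 2 * pOv P (hsDiameter σ N) / (1 - geomRatio P σ) ^ 2 =
      8 * (2 * Real.exp 1 ^ 2 * pOv P (hsDiameter σ N) / (1 - geomRatio P σ) ^ 2) := by ring
  linarith [hinv, h2κ, hX]

/-- **Level-Lipschitz bound, `p_{ε_N}` form**: `|q_N(m+1) - q_N(m)| ≤ (32 e²/(1-θ)²) p_{ε_N}` for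
`m + 1 ≤ N` (strong induction on `m` with the step above: `16 + 32/2 = 32`). -/
theorem ratioLip_qN_succ_sub_le_pOv (hs : SmallDensity P σ) (N : ℕ) :
    ∀ m, m + 1 ≤ N → |qN P σ N (m + 1) - qN P σ N m| ≤
      32 * Real.exp 1 ^ 2 / (1 - geomRatio P σ) ^ 2 * pOv P (hsDiameter σ N) := by
  intro m
  induction m using Nat.strong_induction_on with
  | _ m ih =>
    intro hm
    have hp : 0 ≤ pOv P (hsDiameter σ N) := pOv_nonneg P (hsDiameter_nonneg' hs.σ_pos.le N)
    have hD : 0 ≤ 32 * Real.exp 1 ^ 2 / (1 - geomRatio P σ) ^ 2 * pOv P (hsDiameter σ N) := by positivity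
    refine (ratioLip_abs_qN_succ_sub_le_step hs hm hD (fun k hk => ih k (by omega) (by omega))).trans
      (le_of_eq ?_)
    ring

end

/-- **Level-Lipschitz bound for the insertion ratios of the canonical hard-sphere gas.** Under the
smallness conditions `SmallDensity P σ`, the inverse insertion probabilities
`q_N(m) = Ξ_N(m)/Ξ_N(m+1)` of the `N + 1` hard spheres of diameter `ε_N = σ (N+1)^{-1/3}` on `𝕋³` with
one-particle law `β dy` satisfy, for `k + 1 ≤ N`,
`|q_N(k+1) - q_N(k)| ≤ (32 e² / (1 - θ)²) · λ/(N+1)`, `λ = ovDensity P σ`, `θ = 2eλ = geomRatio P σ`: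
adding one sphere to the gas changes the insertion probability of the next by `O(λ/(N+1))`
(one exclusion volume). Piece (a) of the `s = 0` inhomogeneous rung of `stub_mesoVariance`. -/
theorem ratioLip_qN_succ_sub_le {P : DensityProfile} {σ : ℝ} (hs : SmallDensity P σ) {N k : ℕ}
    (hk : k + 1 ≤ N) :
    |qN P σ N (k + 1) - qN P σ N k| ≤
      32 * Real.exp 1 ^ 2 / (1 - geomRatio P σ) ^ 2 * (ovDensity P σ / ((N : ℝ) + 1)) := by
  have h := ratioLip_qN_succ_sub_le_pOv hs N k hk
  rw [pOv_hsDiameter, Nat.cast_succ] at h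
  exact h

/-- **Registered stub `ratioLipschitz`** (closed form of `ratioLip_qN_succ_sub_le`, all hypotheses as
binders): under `SmallDensity P σ`, `|q_N(k+1) - q_N(k)| ≤ (32 e²/(1-θ)²) · λ/(N+1)` for `k + 1 ≤ N`. -/
theorem ratioLipschitz : ∀ (P : DensityProfile) (σ : ℝ), SmallDensity P σ → ∀ (N k : ℕ), k + 1 ≤ N →
    |qN P σ N (k + 1) - qN P σ N k| ≤
      32 * Real.exp 1 ^ 2 / (1 - geomRatio P σ) ^ 2 * (ovDensity P σ / ((N : ℝ) + 1)) :=
  fun _ _ hs _ _ hk => ratioLip_qN_succ_sub_le hs hk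

end Summit.AtomisticToContinuum.HydrodynamicLimit.Theorems.MesoChebyshevWindow
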